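import Mathlib
import Literature.NumberTheory.Sieve.GoldbachLinnikRomanovCertDefs
import Literature.NumberTheory.Sieve.GoldbachLinnikRomanovConstBound
import Literature.NumberTheory.LFunctions.ChainTableFacts

/-!
# Romanov certificate — soundness I: the checkers

What the kernel checkers of `…Defs.lean` prove about generic records `recs`:
§1–§2 the cofactor check (`cofCheck_sound`: `c_e` is coprime to the table product; `dvd_cOf`: an unlisted prime of
order `e` divides `c_e`), §3 small-number factorisation and the Möbius tags, §4 the record certificate
(`certAll_sound`: listed `q` are primes of the stated order), §5 the head loop in closed form (`headSums_eq`).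

References: D. R. Heath-Brown, J.-C. Puchta, *Integers represented as a sum of primes and powers of two*,
Asian J. Math. 6 (2002) [HeathbrownPuchta2002] (§5: the quantity `R₀ = Σ_t f₁(t)/ξ(t)` and its numerical treatment);
J. Pintz, I. Z. Ruzsa, *On Linnik's approximation to Goldbach's problem, I*, Acta Arith. 109 (2003), 169–194
[PintzRuzsa2003] ((8.14): `1.936 < R₀ < 1.94` in print).
-/

namespace Literature.NumberTheory.Sieve.RomanovCert

open Literature.NumberTheory.Sieve.Romanov

/-! ## §1 List products, the product tree and the batch coprimality test -/

/-- `lprod (l₁ ++ l₂) = lprod l₁ · lprod l₂`. [folklore] -/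
theorem lprod_append (l₁ l₂ : List ℕ) : lprod (l₁ ++ l₂) = lprod l₁ * lprod l₂ := by
  induction l₁ with
  | nil => simp [lprod]
  | cons c t ih => simp [lprod, ih, mul_assoc]

/-- Members divide the product. [folklore] -/
theorem dvd_lprod {c : ℕ} {l : List ℕ} (h : c ∈ l) : c ∣ lprod l := by
  induction l with
  | nil => cases h
  | cons a t ih =>
    rcases List.mem_cons.1 h with rfl | h
    · exact Dvd.intro _ rfl
    · exact (ih h).mul_left _

/-- Value of a binary-counter stack. [folklore] -/
def stackVal : List (ℕ × ℕ) → ℕ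
  | [] => 1
  | (_, v) :: t => v * stackVal t

/-- `mulStack` multiplies out. [folklore] -/
theorem mulStack_eq (st : List (ℕ × ℕ)) (acc : ℕ) : mulStack st acc = acc * stackVal st := by
  induction st generalizing acc with
  | nil => simp [mulStack, stackVal]
  | cons x t ih =>
    obtain ⟨l, v⟩ := x
    simp [mulStack, stackVal, ih, mul_assoc]

/-- `pushLvl` multiplies the stack value by `v`. [folklore] -/
theorem stackVal_pushLvl (st : List (ℕ × ℕ)) (l v : ℕ) :
    stackVal (pushLvl st l v) = v * stackVal st := by
  induction st generalizing l v with
  | nil => simp [pushLvl, stackVal]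
  | cons x t ih =>
    obtain ⟨l', v'⟩ := x
    simp only [pushLvl]
    cases Nat.beq l' l <;> simp [stackVal, ih, mul_comm, mul_assoc]

/-- The strict chunked fold computes the product. [folklore] -/
theorem prodFold_eq : ∀ (f : ℕ) (l : List ℕ) (n acc : ℕ) (st : List (ℕ × ℕ)), l.length ≤ f →
    prodFold f l n acc st = acc * lprod l * stackVal st := by
  intro f
  induction f with
  | zero =>
    intro l n acc st hl
    have : l = [] := List.eq_nil_of_length_eq_zero (Nat.le_zero.1 hl)
    subst this
    simp [prodFold, mulStack_eq, lprod]
  | succ f ih =>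
    intro l n acc st hl
    cases l with
    | nil => simp [prodFold, mulStack_eq, lprod]
    | cons p rest =>
      have hl' : rest.length ≤ f := by simpa using hl
      cases n with
      | zero =>
        simp only [prodFold]
        rw [ih rest 63 p _ hl', stackVal_pushLvl, lprod]
        ring
      | succ n =>
        simp only [prodFold]
        rw [ih rest n (acc * p) st hl', lprod]
        ring

/-- `listProd fuel l = ∏ l` when `|l| ≤ fuel`. [folklore] -/
theorem listProd_eq {fuel : ℕ} {l : List ℕ} (h : l.length ≤ fuel) : listProd fuel l = lprod l := by
  simp [listProd, prodFold_eq fuel l 0 1 [] h, stackVal]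

/-- [folklore] -/
@[simp] theorem PTree.val_leaf (c : ℕ) : (PTree.leaf c).val = c := rfl
/-- [folklore] -/
@[simp] theorem PTree.val_node (p : ℕ) (l r : PTree) : (PTree.node p l r).val = p := rfl

/-- The product tree's root is the product. [folklore] -/
theorem buildPT_val : ∀ (d : ℕ) (l : List ℕ), (buildPT d l).val = lprod l := by
  intro d
  induction d with
  | zero => intro l; rfl
  | succ d ih =>
    intro l
    match l with
    | [] => rfl
    | [c] => show c = c * 1; simp
    | a :: b :: t =>
      simp only [buildPT, PTree.val_node]
      rw [ih, ih, ← lprod_append, List.take_append_drop]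

/-- `gcd(a, R mod a) = 1 ⇒ gcd(a, R) = 1`. [folklore] -/
theorem coprime_of_coprime_mod {a R : ℕ} (h : Nat.Coprime a (R % a)) : Nat.Coprime a R := by
  unfold Nat.Coprime at *
  rw [Nat.gcd_rec, Nat.gcd_comm]
  exact h

/-- Soundness of the remainder-tree descent. [folklore] -/
theorem allCoprime_sound : ∀ (d : ℕ) (l : List ℕ) (R : ℕ),
    allCoprime (buildPT d l) R = true → Nat.Coprime (lprod l) R := by
  intro d
  induction d with
  | zero =>
    intro l R h
    simp only [buildPT, allCoprime] at h
    exact coprime_of_coprime_mod (Nat.eq_of_beq_eq_true h)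
  | succ d ih =>
    intro l R h
    match l, h with
    | [], _ => simp [lprod]
    | [c], h =>
      simp only [buildPT, allCoprime] at h
      have := coprime_of_coprime_mod (Nat.eq_of_beq_eq_true h)
      simpa [lprod] using this
    | a :: b :: t, h =>
      simp only [buildPT, allCoprime, Bool.and_eq_true] at h
      obtain ⟨h1, h2⟩ := h
      rw [buildPT_val] at h1 h2
      have c1 := coprime_of_coprime_mod (ih _ _ h1)
      have c2 := coprime_of_coprime_mod (ih _ _ h2)
      have := Nat.Coprime.mul_left c1 c2
      rwa [← lprod_append, List.take_append_drop] at this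

/-- **Batch soundness**: every modulus of an accepted batch is coprime to `T`. [folklore] -/
theorem checkBatch_sound {T : ℕ} {cur : List ℕ} (h : checkBatch T cur = true) :
    ∀ c ∈ cur, Nat.Coprime c T := by
  intro c hc
  simp only [checkBatch] at h
  rw [buildPT_val] at h
  exact Nat.Coprime.coprime_dvd_left (dvd_lprod hc) (coprime_of_coprime_mod (allCoprime_sound _ _ _ h))

/-- Soundness of the cofactor loop. [folklore] -/
theorem cofLoop_sound (T bb : ℕ) (tr : Tr) : ∀ (f e : ℕ) (cur : List ℕ) (bits : ℕ),
    cofLoop T bb tr f e cur bits = true →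
      (∀ c ∈ cur, Nat.Coprime c T) ∧ ∀ i < f, Nat.Coprime (cOf (e + i) (leafQs tr (e + i))) T := by
  intro f
  induction f with
  | zero =>
    intro e cur bits h
    exact ⟨checkBatch_sound h, fun i hi => absurd hi (Nat.not_lt_zero _)⟩
  | succ f ih =>
    intro e cur bits h
    simp only [cofLoop] at h
    cases hb : Nat.ble bb (bits + e) with
    | true =>
      rw [hb] at h
      simp only [cond_true, Bool.and_eq_true] at h
      obtain ⟨h1, h2⟩ := h
      have hB := checkBatch_sound h1
      obtain ⟨-, hR⟩ := ih (e + 1) [] 0 h2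
      refine ⟨fun c hc => hB c (List.mem_cons_of_mem _ hc), fun i hi => ?_⟩
      cases i with
      | zero => simpa using hB _ (List.mem_cons_self ..)
      | succ j =>
        have := hR j (by omega)
        rwa [show e + 1 + j = e + (j + 1) by omega] at this
    | false =>
      rw [hb] at h
      simp only [cond_false] at h
      obtain ⟨hC, hR⟩ := ih (e + 1) _ _ h
      refine ⟨fun c hc => hC c (List.mem_cons_of_mem _ hc), fun i hi => ?_⟩
      cases i with
      | zero => simpa using hC _ (List.mem_cons_self ..)
      | succ j =>
        have := hR j (by omega)
        rwa [show e + 1 + j = e + (j + 1) by omega] at this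

/-- **Cofactor certificate, combinatorial content**: `c_e` is coprime to the table product. [folklore] -/
theorem cofCheck_sound {tbl : List ℕ} {recs : List (ℕ × List ℕ)} {bb e0 len : ℕ}
    (h : cofCheck tbl recs bb e0 len = true) (htbl : tbl.length ≤ 400000) {e : ℕ}
    (h1 : e0 ≤ e) (h2 : e < e0 + len) :
    Nat.Coprime (cOf e (leafQs (mkTree recs) e)) (lprod tbl) := by
  unfold cofCheck at h
  rw [listProd_eq htbl] at h
  have := (cofLoop_sound _ _ _ _ _ _ _ h).2 (e - e0) (by omega)
  rwa [show e0 + (e - e0) = e by omega] at this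

/-! ## §2 Every unlisted prime of order `e` divides `c_e` -/

/-- `divOut` keeps a prime `p ∤ q`. [folklore] -/
theorem dvd_divOut {p q : ℕ} (hp : p.Prime) (hq : ¬ p ∣ q) :
    ∀ (f A : ℕ), p ∣ A → p ∣ divOut f A q := by
  intro f
  induction f with
  | zero => intro A h; exact h
  | succ f ih =>
    intro A hA
    simp only [divOut]
    cases hm : Nat.beq (Nat.mod A q) 0 with
    | false => exact hA
    | true =>
      simp only [cond_true]
      have hqA : q ∣ A := Nat.dvd_of_mod_eq_zero (Nat.eq_of_beq_eq_true hm)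
      refine ih _ ?_
      have hA' : A = A / q * q := (Nat.div_mul_cancel hqA).symm
      rw [hA'] at hA
      rcases (Nat.Prime.dvd_mul hp).1 hA with h | h
      · exact h
      · exact absurd h hq

/-- `divOutList` keeps a prime dividing none of the `qs`. [folklore] -/
theorem dvd_divOutList {p : ℕ} (hp : p.Prime) :
    ∀ (qs : List ℕ) (A : ℕ), (∀ q ∈ qs, ¬ p ∣ q) → p ∣ A → p ∣ divOutList qs A := by
  intro qs
  induction qs with
  | nil => intro A _ h; exact h
  | cons q qs ih =>
    intro A hqs hA
    exact ih _ (fun q' hq' => hqs q' (List.mem_cons_of_mem _ hq')) (dvd_divOut hp (hqs q (List.mem_cons_self ..)) _ _ hA)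

/-- `stripG` keeps a prime `p ∤ g`. [folklore] -/
theorem dvd_stripG {p : ℕ} (hp : p.Prime) :
    ∀ (f A g : ℕ), ¬ p ∣ g → p ∣ A → p ∣ stripG f A g := by
  intro f
  induction f with
  | zero => intro A g _ h; exact h
  | succ f ih =>
    intro A g hg hA
    simp only [stripG]
    cases hd : Nat.beq (Nat.gcd A g) 1 with
    | true => exact hA
    | false =>
      simp only [cond_false]
      have hdg : ¬ p ∣ Nat.gcd A g := fun h => hg (h.trans (Nat.gcd_dvd_right A g))
      refine ih _ _ hdg ?_
      have hA' : A = A / Nat.gcd A g * Nat.gcd A g := (Nat.div_mul_cancel (Nat.gcd_dvd_left A g)).symm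
      rw [hA'] at hA
      rcases (Nat.Prime.dvd_mul hp).1 hA with h | h
      · exact h
      · exact absurd h hdg

/-- `stripAll` keeps a prime of order exactly `e` when every `r ∈ rs` is a divisor `> 1` of `e`. [folklore] -/
theorem dvd_stripAll {p e : ℕ} (hp : p.Prime) (he : ordTwo p = e) (he0 : 0 < e) :
    ∀ (rs : List ℕ) (A : ℕ), (∀ r ∈ rs, 1 < r ∧ r ∣ e) → p ∣ A → p ∣ stripAll e rs A := by
  intro rs
  induction rs with
  | nil => intro A _ h; exact h
  | cons r rs ih =>
    intro A hrs hA
    simp only [stripAll]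
    refine ih _ (fun r' hr' => hrs r' (List.mem_cons_of_mem _ hr')) (dvd_stripG hp _ _ _ ?_ hA)
    obtain ⟨hr1, hre⟩ := hrs r (List.mem_cons_self ..)
    intro hdvd
    rw [show Nat.pow 2 (Nat.div e r) - 1 = 2 ^ (e / r) - 1 from rfl, dvd_two_pow_sub_one_iff, he] at hdvd
    have h1 : 0 < e / r := Nat.div_pos (Nat.le_of_dvd he0 hre) (by omega)
    have h2 : e / r < e := Nat.div_lt_self he0 hr1
    exact absurd (Nat.le_of_dvd h1 hdvd) (not_le.2 h2)

/-- `divCount` output divides the input. [folklore] -/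
theorem divCount_fst_dvd : ∀ (f m p a : ℕ), (divCount f m p a).1 ∣ m := by
  intro f
  induction f with
  | zero => intro m p a; exact dvd_rfl
  | succ f ih =>
    intro m p a
    simp only [divCount]
    cases hm : Nat.beq (Nat.mod m p) 0 with
    | false => exact dvd_rfl
    | true =>
      simp only [cond_true]
      exact (ih _ _ _).trans (Nat.div_dvd_of_dvd (Nat.dvd_of_mod_eq_zero (Nat.eq_of_beq_eq_true hm)))

/-- `divCount` output is positive for a positive input and `p > 1`. [folklore] -/
theorem divCount_fst_pos {p : ℕ} (hp : 1 < p) : ∀ (f m a : ℕ), 0 < m → 0 < (divCount f m p a).1 := by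
  intro f
  induction f with
  | zero => intro m a h; exact h
  | succ f ih =>
    intro m a hm0
    simp only [divCount]
    cases hm : Nat.beq (Nat.mod m p) 0 with
    | false => exact hm0
    | true =>
      simp only [cond_true]
      refine ih _ _ (Nat.div_pos ?_ (by omega))
      exact Nat.le_of_dvd hm0 (Nat.dvd_of_mod_eq_zero (Nat.eq_of_beq_eq_true hm))

/-- Members of `facSm ps m` are divisors `> 1` of `m` (for `ps` of numbers `> 1`, `m > 0`). [folklore] -/
theorem facSm_fst_dvd : ∀ (ps : List ℕ), (∀ p ∈ ps, 1 < p) → ∀ m, 0 < m →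
    ∀ x ∈ facSm ps m, 1 < x.1 ∧ x.1 ∣ m := by
  intro ps
  induction ps with
  | nil =>
    intro _ m hm x hx
    simp only [facSm] at hx
    cases h1 : Nat.blt 1 m with
    | false => rw [h1] at hx; simp at hx
    | true =>
      rw [h1] at hx
      simp only [cond_true, List.mem_singleton] at hx
      subst hx
      exact ⟨by simpa using h1, dvd_rfl⟩
  | cons p ps ih =>
    intro hps m hm x hx
    have hp1 : 1 < p := hps p (List.mem_cons_self ..)
    have hps' : ∀ p' ∈ ps, 1 < p' := fun p' h => hps p' (List.mem_cons_of_mem _ h)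
    simp only [facSm] at hx
    cases hlt : Nat.blt m (p * p) with
    | true =>
      rw [hlt] at hx
      simp only [cond_true] at hx
      cases h1 : Nat.blt 1 m with
      | false => rw [h1] at hx; simp at hx
      | true =>
        rw [h1] at hx
        simp only [cond_true, List.mem_singleton] at hx
        subst hx
        exact ⟨by simpa using h1, dvd_rfl⟩
    | false =>
      rw [hlt] at hx
      simp only [cond_false] at hx
      cases hmod : Nat.beq (Nat.mod m p) 0 with
      | false =>
        rw [hmod] at hx
        exact ih hps' m hm x hx
      | true =>
        rw [hmod] at hx
        simp only [cond_true, List.mem_cons] at hx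
        have hpm : p ∣ m := Nat.dvd_of_mod_eq_zero (Nat.eq_of_beq_eq_true hmod)
        rcases hx with rfl | hx
        · exact ⟨hp1, hpm⟩
        · have hpos : 0 < m / p := Nat.div_pos (Nat.le_of_dvd hm hpm) (by omega)
          obtain ⟨h1, h2⟩ := ih hps' _ (divCount_fst_pos hp1 _ _ _ hpos) x hx
          exact ⟨h1, h2.trans ((divCount_fst_dvd _ _ _ _).trans (Nat.div_dvd_of_dvd hpm))⟩

/-- The trial-division base consists of numbers `> 1`. [folklore] -/
theorem one_lt_of_mem_smallPrimes : ∀ p ∈ smallPrimes, 1 < p := by decide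

/-- Members of `pdivs m` are divisors `> 1` of `m > 0`. [folklore] -/
theorem pdivs_spec {m : ℕ} (hm : 0 < m) : ∀ r ∈ pdivs m, 1 < r ∧ r ∣ m := by
  intro r hr
  simp only [pdivs, List.mem_map] at hr
  obtain ⟨x, hx, rfl⟩ := hr
  exact facSm_fst_dvd _ one_lt_of_mem_smallPrimes m hm x hx

/-- **Every prime of order `e` dividing none of the listed `qs` divides the cofactor `c_e`.** [folklore] -/
theorem dvd_cOf {p e : ℕ} (hp : p.Prime) (he : ordTwo p = e) (he0 : 0 < e) {qs : List ℕ}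
    (hqs : ∀ q ∈ qs, ¬ p ∣ q) : p ∣ cOf e qs := by
  unfold cOf
  refine dvd_divOutList hp _ _ hqs (dvd_stripAll hp he he0 _ _ (pdivs_spec he0) ?_)
  rw [show Nat.pow 2 e - 1 = 2 ^ e - 1 from rfl, dvd_two_pow_sub_one_iff, he]

/-- **The cofactor certificate**: an accepted range certifies that every prime of order
`e ∈ [e0, e0 + len)` dividing no listed `q` of order `e` exceeds the table bound `P`
(`tbl` containing every prime `≤ P`). [folklore] -/
theorem lt_prime_of_cofCheck {tbl : List ℕ} {recs : List (ℕ × List ℕ)} {bb e0 len P : ℕ}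
    (h : cofCheck tbl recs bb e0 len = true) (htbl : tbl.length ≤ 400000)
    (hcomplete : ∀ p, p.Prime → p ≤ P → p ∈ tbl) {p e : ℕ} (hp : p.Prime) (he : ordTwo p = e)
    (h1 : e0 ≤ e) (h2 : e < e0 + len) (he0 : 0 < e)
    (hq : ∀ q ∈ leafQs (mkTree recs) e, ¬ p ∣ q) : P < p := by
  by_contra hle
  have hmem := hcomplete p hp (not_lt.1 hle)
  have hc := cofCheck_sound h htbl h1 h2
  have h1' : p ∣ Nat.gcd (cOf e (leafQs (mkTree recs) e)) (lprod tbl) :=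
    Nat.dvd_gcd (dvd_cOf hp he he0 hq) (dvd_lprod hmem)
  rw [hc] at h1'
  exact hp.one_lt.ne' (Nat.dvd_one.1 h1')


/-! ## §3 The small factorisation routine `facSm` -/

/-- `smallPrimes` is strictly increasing. [folklore] -/
theorem smallPrimes_sorted : smallPrimes.Pairwise (· < ·) := by decide

/-- Every `p < 182` is listed, or `< 2`, or has a divisor in `[2, p)`. [folklore] -/
theorem smallPrimes_cover : ∀ p < 182, p ∈ smallPrimes ∨ p < 2 ∨
    (List.range p).any (fun d => Nat.ble 2 d && Nat.beq (Nat.mod p d) 0) = true := by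
  decide +kernel

/-- Every prime `< 182` is in `smallPrimes`. [folklore] -/
theorem mem_smallPrimes_of_prime {p : ℕ} (hp : p.Prime) (hlt : p < 182) : p ∈ smallPrimes := by
  rcases smallPrimes_cover p hlt with h | h | h
  · exact h
  · exact absurd hp.two_le (not_le.2 h)
  · exfalso
    simp only [List.any_eq_true, List.mem_range, Bool.and_eq_true] at h
    obtain ⟨d, hd, h2, hmod⟩ := h
    have h2' : 2 ≤ d := by simpa using h2
    have hdvd : d ∣ p := Nat.dvd_of_mod_eq_zero (Nat.eq_of_beq_eq_true hmod)
    rcases (Nat.dvd_prime hp).1 hdvd with rfl | rfl <;> omega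

/-- `smallPrimes` consists of primes below `182`. [folklore] -/
theorem smallPrimes_spec : ∀ p ∈ smallPrimes, p.Prime ∧ p < 182 := by
  simp only [smallPrimes, List.forall_mem_cons]
  norm_num

/-- [folklore] -/
theorem beq_mod_false_iff {m p : ℕ} : Nat.beq (Nat.mod m p) 0 = false ↔ ¬ p ∣ m := by
  rw [← Bool.not_eq_true, Nat.beq_eq]
  exact not_congr ⟨fun h => Nat.dvd_of_mod_eq_zero h, fun h => Nat.mod_eq_zero_of_dvd h⟩

/-- Specification of `divCount`: `r.1 · p^{r.2} = m · p^a`, `a ≤ r.2`, `p ∤ r.1`, `0 < r.1`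
(fuel `f` with `m < 2^f`). [folklore] -/
theorem divCount_spec {p : ℕ} (hp : 1 < p) : ∀ (f m a : ℕ), 0 < m → m < 2 ^ f →
    (divCount f m p a).1 * p ^ (divCount f m p a).2 = m * p ^ a ∧ a ≤ (divCount f m p a).2 ∧
      ¬ p ∣ (divCount f m p a).1 ∧ 0 < (divCount f m p a).1 := by
  intro f
  induction f with
  | zero => intro m a h0 hf; omega
  | succ f ih =>
    intro m a h0 hf
    simp only [divCount]
    cases hm : Nat.beq (Nat.mod m p) 0 with
    | false =>
      simp only [cond_false]
      exact ⟨by simp, by simp, beq_mod_false_iff.1 hm, h0⟩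
    | true =>
      simp only [cond_true]
      change (divCount f (m / p) p (a + 1)).1 * p ^ (divCount f (m / p) p (a + 1)).2 = m * p ^ a ∧
        a ≤ (divCount f (m / p) p (a + 1)).2 ∧ ¬ p ∣ (divCount f (m / p) p (a + 1)).1 ∧
        0 < (divCount f (m / p) p (a + 1)).1
      have hpm : p ∣ m := Nat.dvd_of_mod_eq_zero (Nat.eq_of_beq_eq_true hm)
      have hpos : 0 < m / p := Nat.div_pos (Nat.le_of_dvd h0 hpm) (by omega)
      have hlt : m / p < 2 ^ f := by
        have : m / p ≤ m / 2 := Nat.div_le_div_left hp (by norm_num)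
        omega
      obtain ⟨h1, h2, h3, h4⟩ := ih (m / p) (a + 1) hpos hlt
      refine ⟨?_, by omega, h3, h4⟩
      rw [h1, pow_succ, show m / p * (p ^ a * p) = (m / p * p) * p ^ a by ring, Nat.div_mul_cancel hpm]

/-- The output invariant of `facSm`: strictly increasing primes `≥ b` with positive exponents
whose prime-power product is `m`. [folklore] -/
def FacOK (b m : ℕ) (L : List (ℕ × ℕ)) : Prop :=
  (L.map Prod.fst).Pairwise (· < ·) ∧ (∀ x ∈ L, x.1.Prime ∧ b ≤ x.1 ∧ 1 ≤ x.2) ∧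
    m = (L.map fun x => x.1 ^ x.2).prod

/-- A number `1 < m < B²` with no prime factor `< B` is prime. [folklore] -/
theorem prime_of_no_small_factor {m B : ℕ} (h1 : 1 < m) (hB : m < B * B)
    (h : ∀ q, q.Prime → q < B → ¬ q ∣ m) : m.Prime := by
  by_contra hm
  have hmf := Nat.minFac_prime (show m ≠ 1 by omega)
  have hsq := Nat.minFac_sq_le_self (show 0 < m by omega) hm
  have hlt : m.minFac < B := by
    by_contra hge
    push Not at hge
    have : B * B ≤ m.minFac ^ 2 := by rw [sq]; exact Nat.mul_le_mul hge hge
    omega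
  exact h _ hmf hlt (Nat.minFac_dvd m)

/-- **Correctness of `facSm`.** [folklore] -/
theorem facSm_spec : ∀ (ps : List ℕ) (m b : ℕ), ps.Pairwise (· < ·) →
    (∀ p ∈ ps, p.Prime ∧ b ≤ p ∧ p < 182) → (∀ q, q.Prime → b ≤ q → q < 182 → q ∈ ps) →
    0 < m → m < 182 * 182 → (∀ q, q.Prime → q < b → ¬ q ∣ m) → FacOK b m (facSm ps m) := by
  intro ps
  induction ps with
  | nil =>
    intro m b _ _ hall hm0 hm hb
    simp only [facSm]
    cases h1 : Nat.blt 1 m with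
    | false =>
      have : m = 1 := by rw [← Bool.not_eq_true, Nat.blt_eq] at h1; omega
      subst this
      exact ⟨List.Pairwise.nil, fun x hx => by simp at hx, by simp⟩
    | true =>
      have h1' : 1 < m := by simpa using h1
      have hprime : m.Prime := prime_of_no_small_factor h1' hm fun q hq hqB hqm => by
        by_cases hqb : q < b
        · exact hb q hq hqb hqm
        · exact absurd (hall q hq (not_lt.1 hqb) hqB) (by simp)
      have hbm : b ≤ m := by
        by_contra hlt
        exact hb m hprime (not_le.1 hlt) dvd_rfl
      refine ⟨by simp, fun x hx => ?_, by simp⟩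
      simp only [cond_true, List.mem_singleton] at hx
      subst hx
      exact ⟨hprime, hbm, le_rfl⟩
  | cons p ps ih =>
    intro m b hsort hps hall hm0 hm hb
    have hp := hps p (List.mem_cons_self ..)
    have hps' : ∀ p' ∈ ps, p'.Prime ∧ p + 1 ≤ p' ∧ p' < 182 := fun p' h' =>
      ⟨(hps p' (List.mem_cons_of_mem _ h')).1, (List.pairwise_cons.1 hsort).1 p' h',
        (hps p' (List.mem_cons_of_mem _ h')).2.2⟩
    have hsort' : ps.Pairwise (· < ·) := (List.pairwise_cons.1 hsort).2
    have hall' : ∀ q, q.Prime → p + 1 ≤ q → q < 182 → q ∈ ps := by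
      intro q hq h1 h2
      rcases List.mem_cons.1 (hall q hq (hp.2.1.trans (by omega)) h2) with rfl | h
      · omega
      · exact h
    -- no prime in `[b, p)`:
    have hgap : ∀ q, q.Prime → q < p → ¬ q ∣ m := by
      intro q hq hqp
      by_cases hqb : q < b
      · exact hb q hq hqb
      · rcases List.mem_cons.1 (hall q hq (not_lt.1 hqb) (hqp.trans hp.2.2)) with rfl | h
        · exact absurd hqp (lt_irrefl _)
        · exact absurd ((List.pairwise_cons.1 hsort).1 q h) (by omega)
    have weaken : ∀ L, FacOK (p + 1) m L → FacOK b m L := fun L ⟨h1, h2, h3⟩ =>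
      ⟨h1, fun x hx => ⟨(h2 x hx).1, hp.2.1.trans (by have := (h2 x hx).2.1; omega), (h2 x hx).2.2⟩, h3⟩
    simp only [facSm]
    cases hlt : Nat.blt m (p * p) with
    | true =>
      simp only [cond_true]
      have hlt' : m < p * p := by simpa using hlt
      cases h1 : Nat.blt 1 m with
      | false =>
        have : m = 1 := by rw [← Bool.not_eq_true, Nat.blt_eq] at h1; omega
        subst this
        exact ⟨List.Pairwise.nil, fun x hx => by simp at hx, by simp⟩
      | true =>
        have h1' : 1 < m := by simpa using h1
        have hprime : m.Prime := prime_of_no_small_factor h1' hlt' hgap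
        have hbm : b ≤ m := by
          by_contra hlt2
          exact hb m hprime (not_le.1 hlt2) dvd_rfl
        refine ⟨by simp, fun x hx => ?_, by simp⟩
        simp only [cond_true, List.mem_singleton] at hx
        subst hx
        exact ⟨hprime, hbm, le_rfl⟩
    | false =>
      simp only [cond_false]
      cases hmod : Nat.beq (Nat.mod m p) 0 with
      | false =>
        simp only [cond_false]
        refine weaken _ (ih m (p + 1) hsort' hps' hall' hm0 hm fun q hq hqp => ?_)
        rcases (show q < p ∨ q = p by omega) with h | rfl
        · exact hgap q hq h
        · exact beq_mod_false_iff.1 hmod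
      | true =>
        simp only [cond_true]
        have hpm : p ∣ m := Nat.dvd_of_mod_eq_zero (Nat.eq_of_beq_eq_true hmod)
        have hp1 : 1 < p := hp.1.one_lt
        have hpos : 0 < m / p := Nat.div_pos (Nat.le_of_dvd hm0 hpm) (by omega)
        have hlt2 : m / p < 2 ^ 20 := by
          have : m / p ≤ m := Nat.div_le_self _ _
          omega
        obtain ⟨d1, d2, d3, d4⟩ := divCount_spec hp1 20 (m / p) 1 hpos hlt2
        set r := divCount 20 (Nat.div m p) p 1 with hr
        have hr' : divCount 20 (m / p) p 1 = r := rfl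
        rw [hr'] at d1 d2 d3 d4
        rw [pow_one, Nat.div_mul_cancel hpm] at d1
        -- recursive call on `r.1` with bound `p + 1`
        have hrm : r.1 ∣ m := ⟨p ^ r.2, d1.symm⟩
        have hrec := ih r.1 (p + 1) hsort' hps' hall' d4
          (lt_of_le_of_lt (Nat.le_of_dvd hm0 hrm) hm) fun q hq hqp => by
            rcases (show q < p ∨ q = p by omega) with h | rfl
            · exact fun hd => hgap q hq h (hd.trans hrm)
            · exact d3
        obtain ⟨e1, e2, e3⟩ := hrec
        refine ⟨?_, ?_, ?_⟩
        · simp only [List.map_cons, List.pairwise_cons]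
          refine ⟨fun q hq => ?_, e1⟩
          simp only [List.mem_map] at hq
          obtain ⟨x, hx, rfl⟩ := hq
          have := (e2 x hx).2.1
          omega
        · intro x hx
          rcases List.mem_cons.1 hx with rfl | hx
          · exact ⟨hp.1, hp.2.1, d2⟩
          · obtain ⟨a1, a2, a3⟩ := e2 x hx
            exact ⟨a1, by omega, a3⟩
        · simp only [List.map_cons, List.prod_cons]
          rw [← e3, mul_comm, d1]

/-- `facSm smallPrimes m` for `0 < m < 182²`. [folklore] -/
theorem facSm_ok {m : ℕ} (hm0 : 0 < m) (hm : m < 182 * 182) : FacOK 0 m (facSm smallPrimes m) :=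
  facSm_spec smallPrimes m 0 smallPrimes_sorted
    (fun p hp => ⟨(smallPrimes_spec p hp).1, Nat.zero_le _, (smallPrimes_spec p hp).2⟩)
    (fun _ hq _ h => mem_smallPrimes_of_prime hq h) hm0 hm (fun _ _ h => absurd h (Nat.not_lt_zero _))

/-- A prime factor of `m = ∏ pᵢ^{aᵢ}` (an honest factorisation) is one of the `pᵢ`. [folklore] -/
theorem mem_map_fst_of_prime_dvd {b m : ℕ} {L : List (ℕ × ℕ)} (hL : FacOK b m L) {r : ℕ}
    (hr : r.Prime) (hrm : r ∣ m) : r ∈ L.map Prod.fst := by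
  obtain ⟨-, h2, h3⟩ := hL
  rw [h3] at hrm
  obtain ⟨y, hy, hry⟩ := (Prime.dvd_prod_iff hr.prime).1 hrm
  simp only [List.mem_map] at hy ⊢
  obtain ⟨x, hx, rfl⟩ := hy
  refine ⟨x, hx, ?_⟩
  exact ((Nat.prime_dvd_prime_iff_eq hr (h2 x hx).1).1 (hr.dvd_of_dvd_pow hry)).symm

/-- **Completeness of `pdivs`**: every prime divisor of `0 < m < 182²` is listed. [folklore] -/
theorem mem_pdivs_of_prime_dvd {m r : ℕ} (hm0 : 0 < m) (hm : m < 182 * 182) (hr : r.Prime)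
    (hrm : r ∣ m) : r ∈ pdivs m :=
  mem_map_fst_of_prime_dvd (facSm_ok hm0 hm) hr hrm

/-! ### Möbius values from `facSm` -/

/-- The value encoded by a tag. [folklore] -/
def tagVal : ℕ → ℤ
  | 1 => 1
  | 2 => -1
  | _ => 0

/-- `p ∤ ∏ x.1^{x.2}` when every `x.1` is a prime different from the prime `p`. [folklore] -/
theorem not_dvd_prod_of_forall_ne {p : ℕ} (hp : p.Prime) : ∀ (L : List (ℕ × ℕ)),
    (∀ x ∈ L, x.1.Prime ∧ p ≠ x.1) → ¬ p ∣ (L.map fun x => x.1 ^ x.2).prod := by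
  intro L hL hdvd
  obtain ⟨y, hy, hpy⟩ := (Prime.dvd_prod_iff hp.prime).1 hdvd
  simp only [List.mem_map] at hy
  obtain ⟨x, hx, rfl⟩ := hy
  exact (hL x hx).2 ((Nat.prime_dvd_prime_iff_eq hp (hL x hx).1).1 (hp.dvd_of_dvd_pow hpy))

/-- Tags are `≤ 2`. [folklore] -/
theorem muTag_le_two : ∀ L : List (ℕ × ℕ), muTag L ≤ 2 := by
  intro L
  induction L with
  | nil => simp [muTag]
  | cons x t ih =>
    obtain ⟨p, a⟩ := x
    simp only [muTag]
    cases Nat.blt 1 a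
    · simp only [cond_false]
      generalize muTag t = u at ih ⊢
      rcases u with _ | _ | _ | k <;> simp
    · simp

/-- **`muTag` computes `μ`** on an honest factorisation. [folklore] -/
theorem moebius_eq_tagVal : ∀ (L : List (ℕ × ℕ)) (b m : ℕ), FacOK b m L →
    (ArithmeticFunction.moebius m : ℤ) = tagVal (muTag L) := by
  intro L
  induction L with
  | nil =>
    intro b m ⟨_, _, h3⟩
    simp only [List.map_nil, List.prod_nil] at h3
    subst h3
    simp [muTag, tagVal]
  | cons x t ih =>
    intro b m ⟨h1, h2, h3⟩
    obtain ⟨p, a⟩ := x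
    simp only [List.map_cons, List.prod_cons] at h3
    simp only [List.map_cons, List.pairwise_cons, List.mem_map, forall_exists_index, and_imp,
      forall_apply_eq_imp_iff₂] at h1
    obtain ⟨hlt, ht⟩ := h1
    have hx := h2 (p, a) (List.mem_cons_self ..)
    simp only at hx
    obtain ⟨hp, -, ha⟩ := hx
    have hT : FacOK b (t.map fun x => x.1 ^ x.2).prod t :=
      ⟨ht, fun y hy => h2 y (List.mem_cons_of_mem _ hy), rfl⟩
    have hcop : Nat.Coprime (p ^ a) (t.map fun x => x.1 ^ x.2).prod := by
      refine Nat.Coprime.pow_left _ ((Nat.Prime.coprime_iff_not_dvd hp).2 ?_)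
      exact not_dvd_prod_of_forall_ne hp t fun y hy =>
        ⟨(h2 y (List.mem_cons_of_mem _ hy)).1, (hlt y hy).ne⟩
    rw [h3, ArithmeticFunction.isMultiplicative_moebius.map_mul_of_coprime hcop,
      ArithmeticFunction.moebius_apply_prime_pow hp (by omega), ih b _ hT]
    simp only [muTag]
    cases hba : Nat.blt 1 a with
    | true =>
      have : a ≠ 1 := by
        have h' : 1 < a := by simpa using hba
        omega
      simp [this, tagVal]
    | false =>
      have : a = 1 := by rw [← Bool.not_eq_true, Nat.blt_eq] at hba; omega
      subst this
      rw [if_pos rfl, cond_false]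
      have hle := muTag_le_two t
      generalize muTag t = u at hle ⊢
      rcases u with _ | _ | _ | k
      · simp [tagVal]
      · simp [tagVal]
      · simp [tagVal]
      · omega

/-- `μ(g) = tagVal (muTag (facSm smallPrimes g))` for `0 < g < 182²`. [folklore] -/
theorem moebius_eq_tagVal_facSm {g : ℕ} (hg0 : 0 < g) (hg : g < 182 * 182) :
    (ArithmeticFunction.moebius g : ℤ) = tagVal (muTag (facSm smallPrimes g)) :=
  moebius_eq_tagVal _ 0 g (facSm_ok hg0 hg)

/-! ### Divisors from `facSm` -/

/-- Membership in `expandP`. [folklore] -/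
theorem mem_expandP {p : ℕ} : ∀ (a : ℕ) (ds : List ℕ) (d : ℕ),
    d ∈ expandP p a ds ↔ ∃ i ≤ a, ∃ d' ∈ ds, d = d' * p ^ i := by
  intro a
  induction a with
  | zero =>
    intro ds d
    simp only [expandP, Nat.le_zero, exists_eq_left, pow_zero, mul_one]
    constructor
    · intro h; exact ⟨d, h, rfl⟩
    · rintro ⟨d', h, rfl⟩; exact h
  | succ a ih =>
    intro ds d
    simp only [expandP, List.mem_append, ih, List.mem_map]
    constructor
    · rintro (h | ⟨i, hi, d', ⟨d'', hd'', rfl⟩, rfl⟩)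
      · exact ⟨0, Nat.zero_le _, d, h, by simp⟩
      · exact ⟨i + 1, by omega, d'', hd'', by rw [pow_succ]; ring⟩
    · rintro ⟨i, hi, d', hd', rfl⟩
      cases i with
      | zero => left; simpa using hd'
      | succ i => right; exact ⟨i, by omega, d' * p, ⟨d', hd', rfl⟩, by rw [pow_succ]; ring⟩

/-- **`divsOf` lists exactly the divisors** of an honest factorisation's product. [folklore] -/
theorem mem_divsOf : ∀ (L : List (ℕ × ℕ)) (b m : ℕ), FacOK b m L → ∀ d, d ∈ divsOf L ↔ d ∣ m := by
  intro L
  induction L with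
  | nil =>
    intro b m ⟨_, _, h3⟩ d
    simp only [List.map_nil, List.prod_nil] at h3
    subst h3
    simp [divsOf]
  | cons x t ih =>
    intro b m ⟨h1, h2, h3⟩ d
    obtain ⟨p, a⟩ := x
    simp only [List.map_cons, List.prod_cons] at h3
    have h1' : (∀ q c, (q, c) ∈ t → p < q) ∧ (t.map Prod.fst).Pairwise (· < ·) := by
      simpa using h1
    have hT : FacOK b (t.map fun x => x.1 ^ x.2).prod t :=
      ⟨h1'.2, fun y hy => h2 y (List.mem_cons_of_mem _ hy), rfl⟩
    have hp : p.Prime := (h2 (p, a) (List.mem_cons_self ..)).1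
    simp only [divsOf, mem_expandP, ih b _ hT]
    rw [h3]
    constructor
    · rintro ⟨i, hi, d', hd', rfl⟩
      exact mul_dvd_mul hd' (pow_dvd_pow p hi) |>.trans (by rw [mul_comm])
    · intro hd
      rw [mul_comm] at hd
      obtain ⟨y, z, hy, hz, rfl⟩ := Nat.dvd_mul.1 hd
      obtain ⟨i, hi, rfl⟩ := (Nat.dvd_prime_pow hp).1 hz
      exact ⟨i, hi, y, hy, rfl⟩

/-- Elements of `expandP p a ds` are multiples of elements of `ds`. [folklore] -/
theorem exists_dvd_of_mem_expandP {p : ℕ} : ∀ (a : ℕ) (ds : List ℕ) (d : ℕ),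
    d ∈ expandP p a ds → ∃ d' ∈ ds, d' ∣ d := by
  intro a ds d h
  obtain ⟨i, -, d', hd', rfl⟩ := (mem_expandP a ds d).1 h
  exact ⟨d', hd', Dvd.intro _ rfl⟩

/-- `expandP` preserves duplicate-freeness when `p^(k+1)` divides no element and `p^k` divides all. [folklore] -/
theorem nodup_expandP {p : ℕ} (hp : 1 < p) : ∀ (a : ℕ) (ds : List ℕ) (k : ℕ), ds.Nodup →
    (∀ x ∈ ds, p ^ k ∣ x ∧ ¬ p ^ (k + 1) ∣ x) → (expandP p a ds).Nodup := by
  intro a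
  induction a with
  | zero => intro ds k h _; simpa [expandP] using h
  | succ a ih =>
    intro ds k hnd hk
    simp only [expandP]
    refine List.nodup_append.2 ⟨hnd, ih _ (k + 1) ?_ ?_, ?_⟩
    · exact (List.nodup_map_iff (fun x y h => Nat.eq_of_mul_eq_mul_right (by omega) h)).2 hnd
    · intro x hx
      simp only [List.mem_map] at hx
      obtain ⟨y, hy, rfl⟩ := hx
      obtain ⟨hy1, hy2⟩ := hk y hy
      refine ⟨by rw [pow_succ]; exact mul_dvd_mul hy1 dvd_rfl, fun h => hy2 ?_⟩
      rw [pow_succ] at h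
      exact (Nat.mul_dvd_mul_iff_right (by omega)).1 h
    · intro x hx y hy hxy
      subst hxy
      obtain ⟨d', hd', hd'x⟩ := exists_dvd_of_mem_expandP a _ x hy
      simp only [List.mem_map] at hd'
      obtain ⟨z, hz, rfl⟩ := hd'
      have h1 : p ^ (k + 1) ∣ z * p := by rw [pow_succ]; exact mul_dvd_mul (hk z hz).1 dvd_rfl
      exact (hk x hx).2 (h1.trans hd'x)

/-- **`divsOf` is duplicate-free** on an honest factorisation. [folklore] -/
theorem nodup_divsOf : ∀ (L : List (ℕ × ℕ)) (b m : ℕ), FacOK b m L → (divsOf L).Nodup := by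
  intro L
  induction L with
  | nil => intro _ _ _; simp [divsOf]
  | cons x t ih =>
    intro b m ⟨h1, h2, h3⟩
    obtain ⟨p, a⟩ := x
    have h1' : (∀ q c, (q, c) ∈ t → p < q) ∧ (t.map Prod.fst).Pairwise (· < ·) := by
      simpa using h1
    have hT : FacOK b (t.map fun x => x.1 ^ x.2).prod t :=
      ⟨h1'.2, fun y hy => h2 y (List.mem_cons_of_mem _ hy), rfl⟩
    have hp : p.Prime := (h2 (p, a) (List.mem_cons_self ..)).1
    simp only [divsOf]
    refine nodup_expandP hp.one_lt a _ 0 (ih b _ hT) fun d hd => ⟨by simp, ?_⟩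
    rw [zero_add, pow_one]
    intro hpd
    have hdm : d ∣ (t.map fun x => x.1 ^ x.2).prod := (mem_divsOf t b _ hT d).1 hd
    refine not_dvd_prod_of_forall_ne hp t (fun y hy => ⟨(h2 y (List.mem_cons_of_mem _ hy)).1, ?_⟩)
      (hpd.trans hdm)
    obtain ⟨q, c⟩ := y
    exact (h1'.1 q c hy).ne

/-- `(divsOf (facSm smallPrimes d)).toFinset = d.divisors` for `0 < d < 182²`. [folklore] -/
theorem toFinset_divsOf {d : ℕ} (hd0 : 0 < d) (hd : d < 182 * 182) :
    (divsOf (facSm smallPrimes d)).toFinset = d.divisors := by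
  ext x
  rw [List.mem_toFinset, mem_divsOf _ 0 d (facSm_ok hd0 hd), Nat.mem_divisors]
  exact ⟨fun h => ⟨h, hd0.ne'⟩, fun h => h.1⟩

/-- `divsOf (facSm smallPrimes d)` is duplicate-free for `0 < d < 182²`. [folklore] -/
theorem nodup_divsOf_facSm {d : ℕ} (hd0 : 0 < d) (hd : d < 182 * 182) :
    (divsOf (facSm smallPrimes d)).Nodup :=
  nodup_divsOf _ 0 d (facSm_ok hd0 hd)


/-! ## §4 Record certification and the order tree -/

/-- Soundness of `noCandDiv`: no `c + k·s` with `(c + k s)² ≤ q` divides `q`. [folklore] -/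
theorem noCandDiv_sound : ∀ (f q s c : ℕ), noCandDiv f q s c = true →
    ∀ k, (c + k * s) * (c + k * s) ≤ q → ¬ (c + k * s ∣ q) := by
  intro f
  induction f with
  | zero => intro q s c h; simp [noCandDiv] at h
  | succ f ih =>
    intro q s c h k hk hdvd
    cases hlt : Nat.blt q (c * c) with
    | true =>
      have h1 : q < c * c := by simpa using hlt
      have h2 : c * c ≤ (c + k * s) * (c + k * s) := Nat.mul_le_mul (by omega) (by omega)
      omega
    | false =>
      cases hm : Nat.beq (Nat.mod q c) 0 with
      | true => simp [noCandDiv, hlt, hm] at h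
      | false =>
        simp only [noCandDiv, hlt, hm, cond_false] at h
        cases k with
        | zero => exact beq_mod_false_iff.1 hm (by simpa using hdvd)
        | succ k =>
          have e1 : c + (k + 1) * s = c + s + k * s := by ring
          rw [e1] at hk hdvd
          exact ih q s (c + s) h k hk hdvd

/-- A divisor `d` of `e > 0` dividing no `e / r` (`r` a prime factor of `e`) equals `e`. [folklore] -/
theorem eq_of_dvd_of_not_dvd_div {d e : ℕ} (he : 0 < e) (hd : d ∣ e)
    (h : ∀ r, r.Prime → r ∣ e → ¬ d ∣ e / r) : d = e := by
  obtain ⟨k, rfl⟩ := hd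
  by_contra hne
  have hk1 : k ≠ 1 := by rintro rfl; simp at hne
  obtain ⟨r, hr, j, rfl⟩ := Nat.exists_prime_and_dvd hk1
  refine h r hr (Dvd.intro_left (d * j) (by ring)) ?_
  rw [show d * (r * j) / r = d * j by rw [mul_left_comm, Nat.mul_div_cancel_left _ hr.pos]]
  exact Dvd.intro j rfl

/-- `2^e − 1` is odd for `e ≥ 1`. [folklore] -/
theorem odd_two_pow_sub_one {e : ℕ} (he : 1 ≤ e) : Odd (2 ^ e - 1) := by
  rw [Nat.odd_iff]
  obtain ⟨k, rfl⟩ := Nat.exists_eq_add_of_le he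
  have h2 : 2 ^ (1 + k) = 2 * 2 ^ k := by rw [pow_add, pow_one]
  have h1 : 1 ≤ 2 ^ k := Nat.one_le_two_pow
  omega

/-- For an odd prime `p`, `ord_p(2) ∣ p − 1` (Fermat). [folklore] -/
theorem ordTwo_dvd_sub_one {p : ℕ} (hp : p.Prime) (hodd : Odd p) : ordTwo p ∣ p - 1 := by
  haveI := Fact.mk hp
  show orderOf (2 : ZMod p) ∣ p - 1
  refine ZMod.orderOf_dvd_card_sub_one ?_
  intro h
  have h' : ((2 : ℕ) : ZMod p) = 0 := by simpa using h
  have hdvd : p ∣ 2 := (ZMod.natCast_eq_zero_iff 2 p).1 h'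
  have hle : p ≤ 2 := Nat.le_of_dvd (by norm_num) hdvd
  have h2 := hp.two_le
  have : p = 2 := by omega
  subst this
  exact absurd hodd (by decide)

/-- `s_e ∣ n` whenever `e ∣ n` and `2 ∣ n` (`0 < e`). [folklore] -/
theorem sOf_dvd {e n : ℕ} (h1 : e ∣ n) (h2 : 2 ∣ n) : sOf e ∣ n := by
  unfold sOf
  cases hb : Nat.beq (Nat.mod e 2) 0 with
  | true => simpa using h1
  | false =>
    simp only [cond_false]
    have hodd : Odd e := by
      rw [Nat.odd_iff]
      have := beq_mod_false_iff.1 hb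
      omega
    exact Nat.Coprime.mul_dvd_of_dvd_of_dvd (Nat.coprime_two_left.2 hodd) h2 h1

/-- `e ≤ s_e`. [folklore] -/
theorem le_sOf (e : ℕ) : e ≤ sOf e := by
  unfold sOf
  cases Nat.beq (Nat.mod e 2) 0
  · simp; omega
  · simp

/-- **Soundness of `certQ`**: a certified `q` is a prime with `ord_q(2) = e`. [folklore] -/
theorem certQ_sound {e q : ℕ} (he2 : 2 ≤ e) (he : e < 182 * 182)
    (h : certQ e (2 ^ e - 1) ((pdivs e).map fun r => 2 ^ (e / r) - 1) q = true) :
    q.Prime ∧ ordTwo q = e := by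
  simp only [certQ, Bool.and_eq_true, Bool.or_eq_true, List.all_eq_true, List.mem_map,
    forall_exists_index, and_imp] at h
  obtain ⟨⟨⟨h1, hA⟩, hB⟩, hC⟩ := h
  have hq1 : 1 < q := by simpa using h1
  have hqA : q ∣ 2 ^ e - 1 := Nat.dvd_of_mod_eq_zero (Nat.eq_of_beq_eq_true hA)
  have he0 : 0 < e := by omega
  have hodd : Odd (2 ^ e - 1) := odd_two_pow_sub_one (by omega)
  -- every prime factor of `q` has order exactly `e` and is `≡ 1 (mod s_e)`
  have key : ∀ p, p.Prime → p ∣ q → ordTwo p = e ∧ sOf e ∣ p - 1 := by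
    intro p hp hpq
    have hpodd : Odd p := hodd.of_dvd_nat (hpq.trans hqA)
    have h_dvd_e : ordTwo p ∣ e := (dvd_two_pow_sub_one_iff e).1 (hpq.trans hqA)
    have hord : ordTwo p = e := by
      refine eq_of_dvd_of_not_dvd_div he0 h_dvd_e fun r hr hre hdiv => ?_
      have hrmem : r ∈ pdivs e := mem_pdivs_of_prime_dvd he0 he hr hre
      have hB' := hB _ r hrmem rfl
      have hcop : Nat.Coprime q (2 ^ (e / r) - 1) :=
        coprime_of_coprime_mod (Nat.eq_of_beq_eq_true hB')
      have hpB : p ∣ 2 ^ (e / r) - 1 := (dvd_two_pow_sub_one_iff (e / r)).2 hdiv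
      exact hp.one_lt.ne' ((hcop.coprime_dvd_left hpq).eq_one_of_dvd hpB)
    refine ⟨hord, ?_⟩
    have hd1 : e ∣ p - 1 := hord ▸ ordTwo_dvd_sub_one hp hpodd
    have hd2 : 2 ∣ p - 1 := by
      obtain ⟨k, hk⟩ := hpodd
      exact ⟨k, by omega⟩
    exact sOf_dvd hd1 hd2
  have hqprime : q.Prime := by
    by_contra hnp
    have hmf := Nat.minFac_prime (show q ≠ 1 by omega)
    have hmd := Nat.minFac_dvd q
    obtain ⟨-, hs⟩ := key _ hmf hmd
    have hsq := Nat.minFac_sq_le_self (show 0 < q by omega) hnp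
    rw [sq] at hsq
    have h2le := hmf.two_le
    have hsle : sOf e ≤ q.minFac - 1 := Nat.le_of_dvd (by omega) hs
    have hle : e ≤ sOf e := le_sOf e
    rcases hC with hC | hC
    · have hlt : q < (e + 1) * (e + 1) := by simpa using hC
      have : (e + 1) * (e + 1) ≤ q.minFac * q.minFac := Nat.mul_le_mul (by omega) (by omega)
      omega
    · obtain ⟨j, hj⟩ := hs
      have hj1 : 1 ≤ j := by
        rcases Nat.eq_zero_or_pos j with rfl | hj0
        · simp at hj; omega
        · exact hj0
      have hmfeq : q.minFac = (1 + sOf e) + (j - 1) * sOf e := by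
        have e1 : (j - 1) * sOf e = sOf e * j - sOf e := by rw [Nat.sub_one_mul, mul_comm]
        have e2 : sOf e ≤ sOf e * j := Nat.le_mul_of_pos_right _ hj1
        rw [e1]
        generalize sOf e * j = t at hj e2 ⊢
        omega
      refine noCandDiv_sound 4096 q (sOf e) (1 + sOf e) hC (j - 1) ?_ ?_
      · rw [← hmfeq]; exact hsq
      · rw [← hmfeq]; exact hmd
  exact ⟨hqprime, (key q hqprime dvd_rfl).1⟩

/-- Soundness of `certQs`: every member certified, strictly increasing. [folklore] -/
theorem certQs_sound {e A : ℕ} {Bs : List ℕ} : ∀ (qs : List ℕ) (prev : ℕ),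
    certQs e A Bs prev qs = true →
      (∀ q ∈ qs, prev < q ∧ certQ e A Bs q = true) ∧ qs.Pairwise (· < ·) := by
  intro qs
  induction qs with
  | nil => intro prev _; simp
  | cons q qs ih =>
    intro prev h
    simp only [certQs, Bool.and_eq_true] at h
    obtain ⟨⟨h1, h2⟩, h3⟩ := h
    have h1' : prev < q := by simpa using h1
    obtain ⟨ih1, ih2⟩ := ih q h3
    refine ⟨fun x hx => ?_, List.pairwise_cons.2 ⟨fun x hx => (ih1 x hx).1, ih2⟩⟩
    rcases List.mem_cons.1 hx with rfl | hx
    · exact ⟨h1', h2⟩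
    · exact ⟨h1'.trans (ih1 x hx).1, (ih1 x hx).2⟩

/-- **Soundness of `certLeaf`.** [folklore] -/
theorem certLeaf_sound {e : ℕ} {qs : List ℕ} (h : certLeaf e qs = true) (he : e < 182 * 182) :
    (∀ q ∈ qs, q.Prime ∧ ordTwo q = e) ∧ qs.Pairwise (· < ·) ∧ (qs ≠ [] → 2 ≤ e) := by
  cases qs with
  | nil => simp
  | cons q qs =>
    simp only [certLeaf, Bool.and_eq_true] at h
    obtain ⟨h2, h⟩ := h
    have he2 : 2 ≤ e := by simpa using h2
    obtain ⟨hall, hpw⟩ := certQs_sound (e := e) (q :: qs) 0 h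
    exact ⟨fun x hx => certQ_sound he2 he (hall x hx).2, hpw, fun _ => he2⟩

/-! ### The order tree -/

/-- Structural invariant of the order tree at depth `d` over the keys `[kl, kl + 2^d)`. [folklore] -/
def Tr.WF : Tr → ℕ → ℕ → Prop
  | Tr.leaf w bn bd qs, d, kl => d = 0 ∧ w = wOf kl ∧ bn = prodSub 1 qs ∧ bd = prodSub 2 qs
  | Tr.node l r, d, kl => ∃ d', d = d' + 1 ∧ l.WF d' kl ∧ r.WF d' (kl + 2 ^ d')

/-- `buildTr` produces a well-formed tree. [folklore] -/
theorem buildTr_WF : ∀ (d kl : ℕ) (recs : List (ℕ × List ℕ)), (buildTr d kl recs).1.WF d kl := by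
  intro d
  induction d with
  | zero =>
    intro kl recs
    rcases recs with _ | ⟨⟨e', qs⟩, t⟩
    · simp [buildTr, Tr.WF, prodSub]
    · simp only [buildTr]
      cases Nat.beq e' kl <;> simp [Tr.WF, prodSub]
  | succ d ih =>
    intro kl recs
    exact ⟨d, rfl, ih kl recs, ih _ _⟩

/-- `2^(d+1) / 2 = 2^d`. [folklore] -/
theorem two_pow_succ_div_two (d : ℕ) : 2 ^ (d + 1) / 2 = 2 ^ d := by
  rw [pow_succ, Nat.mul_div_cancel _ (by norm_num)]

/-- Lookup in a well-formed tree: the cached leaf fields are the functions of the key and of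
the leaf list. [folklore] -/
theorem Tr.look_spec : ∀ (t : Tr) (d kl e : ℕ), t.WF d kl → e < 2 ^ d →
    (t.look e (2 ^ d / 2)).1 = wOf (kl + e) ∧
    (t.look e (2 ^ d / 2)).2.1 = prodSub 1 (t.look e (2 ^ d / 2)).2.2.2 ∧
    (t.look e (2 ^ d / 2)).2.2.1 = prodSub 2 (t.look e (2 ^ d / 2)).2.2.2 := by
  intro t
  induction t with
  | leaf w bn bd qs =>
    intro d kl e hwf he
    obtain ⟨rfl, rfl, rfl, rfl⟩ := hwf
    have : e = 0 := by simp at he; omega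
    subst this
    simp [Tr.look]
  | node l r ihl ihr =>
    intro d kl e hwf he
    obtain ⟨d', rfl, hl, hr⟩ := hwf
    rw [two_pow_succ_div_two]
    show let v := (bif Nat.blt e (2 ^ d') then l.look e (2 ^ d' / 2)
      else r.look (e - 2 ^ d') (2 ^ d' / 2)); v.1 = wOf (kl + e) ∧ v.2.1 = prodSub 1 v.2.2.2 ∧
        v.2.2.1 = prodSub 2 v.2.2.2
    cases hlt : Nat.blt e (2 ^ d') with
    | true =>
      have he' : e < 2 ^ d' := by simpa using hlt
      exact ihl d' kl e hl he'
    | false =>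
      have he' : ¬ e < 2 ^ d' := by rw [← Bool.not_eq_true, Nat.blt_eq] at hlt; exact hlt
      have h2 : e - 2 ^ d' < 2 ^ d' := by rw [pow_succ] at he; omega
      have := ihr d' (kl + 2 ^ d') (e - 2 ^ d') hr h2
      rw [show kl + 2 ^ d' + (e - 2 ^ d') = kl + e by omega] at this
      exact this

/-- Soundness of `Tr.cert`: every leaf is certified at its key. [folklore] -/
theorem Tr.cert_sound : ∀ (t : Tr) (d kl : ℕ), t.WF d kl → t.cert kl (2 ^ d / 2) = true →
    ∀ e, e < 2 ^ d → certLeaf (kl + e) (t.look e (2 ^ d / 2)).2.2.2 = true := by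
  intro t
  induction t with
  | leaf w bn bd qs =>
    intro d kl hwf h e he
    obtain ⟨rfl, -, -, -⟩ := hwf
    have : e = 0 := by simp at he; omega
    subst this
    simpa [Tr.cert, Tr.look] using h
  | node l r ihl ihr =>
    intro d kl hwf h e he
    obtain ⟨d', rfl, hl, hr⟩ := hwf
    rw [two_pow_succ_div_two] at h ⊢
    change (l.cert kl (2 ^ d' / 2) && r.cert (kl + 2 ^ d') (2 ^ d' / 2)) = true at h
    simp only [Bool.and_eq_true] at h
    show certLeaf (kl + e) (bif Nat.blt e (2 ^ d') then l.look e (2 ^ d' / 2)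
      else r.look (e - 2 ^ d') (2 ^ d' / 2)).2.2.2 = true
    cases hlt : Nat.blt e (2 ^ d') with
    | true => exact ihl d' kl hl h.1 e (by simpa using hlt)
    | false =>
      have he' : ¬ e < 2 ^ d' := by rw [← Bool.not_eq_true, Nat.blt_eq] at hlt; exact hlt
      have h2 : e - 2 ^ d' < 2 ^ d' := by rw [pow_succ] at he; omega
      have := ihr d' (kl + 2 ^ d') hr h.2 (e - 2 ^ d') h2
      rwa [show kl + 2 ^ d' + (e - 2 ^ d') = kl + e by omega] at this

/-- The cached fields of the certificate tree at a key `e < 2^15`. [folklore] -/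
theorem look_mkTree (recs : List (ℕ × List ℕ)) {e : ℕ} (he : e < 32768) :
    ((mkTree recs).look e HALF).1 = wOf e ∧
    ((mkTree recs).look e HALF).2.1 = prodSub 1 (leafQs (mkTree recs) e) ∧
    ((mkTree recs).look e HALF).2.2.1 = prodSub 2 (leafQs (mkTree recs) e) := by
  have h := Tr.look_spec (mkTree recs) 15 0 e (buildTr_WF 15 0 recs) (by norm_num; omega)
  rw [zero_add] at h
  exact h

/-- **Soundness of the record certificate**: for every `e < 2^15` the listed `q`'s are primes
with `ord_q(2) = e`, strictly increasing, and `2 ≤ e` if the list is non-empty. [folklore] -/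
theorem certAll_sound {recs : List (ℕ × List ℕ)} (h : certAll recs = true) {e : ℕ}
    (he : e < 32768) :
    (∀ q ∈ leafQs (mkTree recs) e, q.Prime ∧ ordTwo q = e) ∧
      (leafQs (mkTree recs) e).Pairwise (· < ·) ∧ (leafQs (mkTree recs) e ≠ [] → 2 ≤ e) := by
  have hc := Tr.cert_sound (mkTree recs) 15 0 (buildTr_WF 15 0 recs) h e (by norm_num; omega)
  rw [zero_add] at hc
  exact certLeaf_sound hc (by omega)


/-! ## §5 The head loop: arithmetic invariants -/

/-- [folklore] -/
@[simp] theorem seqN_eq {α : Sort*} (x : ℕ) (k : α) : seqN x k = k := by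
  unfold seqN; cases Nat.beq x x <;> rfl

/-- [folklore] -/
@[simp] theorem seqB_eq {α : Sort*} (b : Bool) (k : α) : seqB b k = k := by
  unfold seqB; cases b <;> rfl


open Finset in
/-- The tag of `g`. [folklore] -/
def tagOf (g : ℕ) : ℕ := muTag (facSm smallPrimes g)

/-- The four Möbius prefix sums at `y`: `(Σ_{μ=1} ⌈2^K/g⌉, Σ_{μ=-1} ⌊2^K/g⌋, #{μ=1}, #{μ=-1})`
over `g ∈ [1, y]` (tags in place of `μ`). [folklore] -/
def muData (y : ℕ) : ℕ × ℕ × ℕ × ℕ :=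
  (∑ g ∈ Finset.Icc 1 y, (if tagOf g = 1 then cdiv (Nat.pow 2 KK) g else 0),
   ∑ g ∈ Finset.Icc 1 y, (if tagOf g = 2 then Nat.div (Nat.pow 2 KK) g else 0),
   ∑ g ∈ Finset.Icc 1 y, (if tagOf g = 1 then 1 else 0),
   ∑ g ∈ Finset.Icc 1 y, (if tagOf g = 2 then 1 else 0))

/-- One step of the prefix data. [folklore] -/
theorem muData_succ (y : ℕ) : muData (y + 1) =
    ((muData y).1 + (if tagOf (y + 1) = 1 then cdiv (Nat.pow 2 KK) (y + 1) else 0),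
     (muData y).2.1 + (if tagOf (y + 1) = 2 then Nat.div (Nat.pow 2 KK) (y + 1) else 0),
     (muData y).2.2.1 + (if tagOf (y + 1) = 1 then 1 else 0),
     (muData y).2.2.2 + (if tagOf (y + 1) = 2 then 1 else 0)) := by
  simp only [muData, Finset.sum_Icc_succ_top (Nat.le_add_left 1 y)]

/-- `muData 0 = 0`. [folklore] -/
theorem muData_zero : muData 0 = (0, 0, 0, 0) := by simp [muData]

/-- `muUp` adds the data of `[g, g + f)`. [folklore] -/
theorem muUp_eq : ∀ (f g mp mn p1 n1 : ℕ), 1 ≤ g →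
    muUp f g mp mn p1 n1 =
      (mp + ((muData (g + f - 1)).1 - (muData (g - 1)).1),
       mn + ((muData (g + f - 1)).2.1 - (muData (g - 1)).2.1),
       p1 + ((muData (g + f - 1)).2.2.1 - (muData (g - 1)).2.2.1),
       n1 + ((muData (g + f - 1)).2.2.2 - (muData (g - 1)).2.2.2)) := by
  intro f
  induction f with
  | zero => intro g mp mn p1 n1 hg; simp [muUp]
  | succ f ih =>
    intro g mp mn p1 n1 hg
    have hstep := muData_succ (g - 1)
    rw [show g - 1 + 1 = g by omega] at hstep
    -- monotonicity facts for the truncated subtractions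
    have hmono : ∀ y y', y ≤ y' → (muData y).1 ≤ (muData y').1 ∧ (muData y).2.1 ≤ (muData y').2.1 ∧
        (muData y).2.2.1 ≤ (muData y').2.2.1 ∧ (muData y).2.2.2 ≤ (muData y').2.2.2 := by
      intro y y' hy
      have hsub : Finset.Icc 1 y ⊆ Finset.Icc 1 y' := Finset.Icc_subset_Icc_right hy
      exact ⟨Finset.sum_le_sum_of_subset hsub, Finset.sum_le_sum_of_subset hsub,
        Finset.sum_le_sum_of_subset hsub, Finset.sum_le_sum_of_subset hsub⟩
    obtain ⟨m1, m2, m3, m4⟩ := hmono g (g + 1 + f - 1) (by omega)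
    simp only [muUp, seqN_eq]
    rw [show g + (f + 1) - 1 = g + 1 + f - 1 by omega]
    rcases htag : tagOf g with _ | _ | _ | k
    · -- tag 0
      rw [show muTag (facSm smallPrimes g) = 0 from htag, ih (g + 1) mp mn p1 n1 (by omega),
        show g + 1 - 1 = g by omega, hstep]
      simp [htag]
    · -- tag 1
      rw [show muTag (facSm smallPrimes g) = 1 from htag, ih (g + 1) _ mn _ n1 (by omega),
        show g + 1 - 1 = g by omega, hstep]
      simp only [htag, if_true, show (1:ℕ) ≠ 2 by decide, if_false, add_zero]
      rw [hstep] at m1 m3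
      simp only [htag, if_true] at m1 m3
      refine Prod.ext ?_ (Prod.ext rfl (Prod.ext ?_ rfl)) <;> simp only <;> omega
    · -- tag 2
      rw [show muTag (facSm smallPrimes g) = 2 from htag, ih (g + 1) mp _ p1 _ (by omega),
        show g + 1 - 1 = g by omega, hstep]
      simp only [htag, if_true]
      rw [hstep] at m2 m4
      simp only [htag, if_true] at m2 m4
      refine Prod.ext rfl (Prod.ext ?_ (Prod.ext rfl ?_)) <;> simp only <;> omega
    · -- tag ≥ 3 (never happens, but harmless)
      rw [show muTag (facSm smallPrimes g) = k + 3 from htag, ih (g + 1) mp mn p1 n1 (by omega),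
        show g + 1 - 1 = g by omega, hstep]
      simp [htag]

/-- `muUp x 1 0 0 0 0 = muData x`. [folklore] -/
theorem muUp_one (x : ℕ) : muUp x 1 0 0 0 0 = muData x := by
  rw [muUp_eq x 1 0 0 0 0 le_rfl]
  simp [muData_zero, show 1 + x - 1 = x by omega]

/-- `muDown f y (muData y) = muData (y − f)` for `f ≤ y`. [folklore] -/
theorem muDown_eq : ∀ (f y : ℕ), f ≤ y →
    muDown f y (muData y).1 (muData y).2.1 (muData y).2.2.1 (muData y).2.2.2 = muData (y - f) := by
  intro f
  induction f with
  | zero => intro y _; simp [muDown]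
  | succ f ih =>
    intro y hf
    obtain ⟨y', rfl⟩ : ∃ y', y = y' + 1 := ⟨y - 1, by omega⟩
    have hstep := muData_succ y'
    simp only [muDown, seqN_eq]
    rw [show y' + 1 - (f + 1) = y' - f by omega, ← ih y' (by omega), show y' + 1 - 1 = y' by omega]
    rcases htag : tagOf (y' + 1) with _ | _ | _ | k
    · rw [show muTag (facSm smallPrimes (y' + 1)) = 0 from htag, hstep]; simp [htag]
    · rw [show muTag (facSm smallPrimes (y' + 1)) = 1 from htag, hstep]
      simp [htag]
    · rw [show muTag (facSm smallPrimes (y' + 1)) = 2 from htag, hstep]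
      simp [htag]
    · rw [show muTag (facSm smallPrimes (y' + 1)) = k + 3 from htag, hstep]; simp [htag]

/-- `accDivs` accumulates the leaf fields over the list. [folklore] -/
theorem accDivs_eq (tr : Tr) : ∀ (es : List ℕ) (X hn hd : ℕ), accDivs tr es X hn hd =
    (X + (es.map fun e => (tr.look e HALF).1).sum,
     hn * (es.map fun e => (tr.look e HALF).2.1).prod,
     hd * (es.map fun e => (tr.look e HALF).2.2.1).prod) := by
  intro es
  induction es with
  | nil => intro X hn hd; simp [accDivs]
  | cons e es ih =>
    intro X hn hd
    simp only [accDivs, ih, List.map_cons, List.sum_cons, List.prod_cons]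
    refine Prod.ext ?_ (Prod.ext ?_ ?_) <;> simp only <;> ring

/-- The per-`d` data of the head loop: `X_d`, `Hn_d`, `Hd_d`. [folklore] -/
def dData (tr : Tr) (d : ℕ) : ℕ × ℕ × ℕ := accDivs tr (divsOf (facSm smallPrimes d)) 0 1 1

/-- `x_d = ⌊(M − 1)/d⌋`. [folklore] -/
def xOf (d : ℕ) : ℕ := Nat.div (MM - 1) d

/-- The five per-`d` increments of the head loop. [folklore] -/
def incr (tr : Tr) (d : ℕ) : ℕ × ℕ × ℕ × ℕ × ℕ :=
  let v := dData tr d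
  let mu := muData (xOf d)
  let sc := Nat.pow 2 KK
  (cdiv (v.2.1 * mu.1) (v.2.2 * d), Nat.div (v.2.1 * mu.2.1) (v.2.2 * d),
   cdiv (sc * v.2.1 * v.1) (v.2.2 * (sc - v.1) * d),
   Nat.div (v.2.1 * mu.2.2.1 * sc) v.2.2, cdiv (v.2.1 * mu.2.2.2 * sc) v.2.2)

/-- `x_d` is antitone. [folklore] -/
theorem xOf_anti {d d' : ℕ} (h : d ≤ d') (hd : 0 < d) : xOf d' ≤ xOf d :=
  Nat.div_le_div_left h hd

/-- Splitting off the first index of an `all` over `Ico`. [folklore] -/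
theorem all_Ico_succ (P : ℕ → Bool) (d n : ℕ) :
    ((Finset.Ico d (d + 1 + n)).toList.all P) =
      (P d && (Finset.Ico (d + 1) (d + 1 + n)).toList.all P) := by
  rw [Bool.eq_iff_iff]
  simp only [List.all_eq_true, Finset.mem_toList, Finset.mem_Ico, Bool.and_eq_true]
  constructor
  · intro h; exact ⟨h d (by omega), fun i hi => h i (by omega)⟩
  · rintro ⟨h1, h2⟩ i hi
    rcases (show i = d ∨ d + 1 ≤ i by omega) with rfl | h
    · exact h1
    · exact h2 i (by omega)

/-- **The head-loop invariant.** [folklore] -/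
theorem headLoop_eq (tr : Tr) : ∀ (f d curx : ℕ) (acc : HAcc), 0 < d → xOf d ≤ curx →
    headLoop tr f d curx (muData curx) acc =
      ⟨acc.tpos + ∑ i ∈ Finset.Ico d (d + f), (incr tr i).1,
       acc.tneg + ∑ i ∈ Finset.Ico d (d + f), (incr tr i).2.1,
       acc.ipos + ∑ i ∈ Finset.Ico d (d + f), (incr tr i).2.2.1,
       acc.spos + ∑ i ∈ Finset.Ico d (d + f), (incr tr i).2.2.2.1,
       acc.sneg + ∑ i ∈ Finset.Ico d (d + f), (incr tr i).2.2.2.2,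
       acc.ok && (Finset.Ico d (d + f)).toList.all fun i => Nat.blt (dData tr i).1 (Nat.pow 2 KK)⟩ := by
  intro f
  induction f with
  | zero =>
    intro d curx acc hd hx
    simp [headLoop]
  | succ f ih =>
    intro d curx acc hd hx
    simp only [headLoop, seqN_eq, seqB_eq]
    have hmu : muDown (curx - Nat.div (MM - 1) d) curx (muData curx).1 (muData curx).2.1
        (muData curx).2.2.1 (muData curx).2.2.2 = muData (xOf d) := by
      rw [muDown_eq _ _ (Nat.sub_le _ _)]
      congr 1
      show curx - (curx - xOf d) = xOf d
      omega
    rw [hmu, show Nat.div (MM - 1) d = xOf d from rfl,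
      ih (d + 1) (xOf d) _ (by omega) (xOf_anti (Nat.le_succ d) hd),
      show d + (f + 1) = d + 1 + f by omega]
    have h1 : d < d + 1 + f := by omega
    rw [Finset.sum_eq_sum_Ico_succ_bot h1, Finset.sum_eq_sum_Ico_succ_bot h1,
      Finset.sum_eq_sum_Ico_succ_bot h1, Finset.sum_eq_sum_Ico_succ_bot h1,
      Finset.sum_eq_sum_Ico_succ_bot h1, all_Ico_succ]
    simp only [incr, dData, xOf, Bool.and_assoc, Nat.add_assoc]

/-- **`headSums` in closed form.** [folklore] -/
theorem headSums_eq (recs : List (ℕ × List ℕ)) {dlo len : ℕ} (hd : 0 < dlo) :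
    headSums recs dlo len =
      (∑ i ∈ Finset.Ico dlo (dlo + len), (incr (mkTree recs) i).1,
       ∑ i ∈ Finset.Ico dlo (dlo + len), (incr (mkTree recs) i).2.1,
       ∑ i ∈ Finset.Ico dlo (dlo + len), (incr (mkTree recs) i).2.2.1,
       ∑ i ∈ Finset.Ico dlo (dlo + len), (incr (mkTree recs) i).2.2.2.1,
       ∑ i ∈ Finset.Ico dlo (dlo + len), (incr (mkTree recs) i).2.2.2.2,
       (Finset.Ico dlo (dlo + len)).toList.all fun i =>
         Nat.blt (dData (mkTree recs) i).1 (Nat.pow 2 KK)) := by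
  simp only [headSums]
  rw [muUp_one, show Nat.div (MM - 1) dlo = xOf dlo from rfl, headLoop_eq _ _ _ _ _ hd le_rfl]
  simp

end Literature.NumberTheory.Sieve.RomanovCert
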